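/-
Copyright (c) 2026. All rights reserved.
Released under Apache 2.0 license as described in the file LICENSE.
-/
import Literature.AlgebraicGeometry.Pohlmann1968.MultiquadraticCMFieldWeilSubfieldsExceptionalClasses
import HarnessLib

/-!
# Exceptional Weil classes times divisor monomials: every realisation of a primitive CM type of a multiquadratic CM
# field of degree `8m` has `dim B^{m+j}(A) − dim D^{m+j}(A) ≥ 4·C([K:ℚ]/2 + 1 − Rank, 2)·C(2m, j)` — degree `32`:
# `dim B⁸ − dim D⁸ ≥ 4200` on every simple degenerate CM `16`-fold

SETTING (tree `MultiquadraticCMFieldWeilSubfieldsExceptionalClasses`, `DivisorClassesCMType`,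
`WeilTypeCMSubfieldExceptionalClasses`).  `K` a CM field, Galois over `ℚ`, `Gal(K/ℚ)` of exponent `2`, `[K:ℚ] = 2g = 8m`;
`Φ` a primitive CM type, `A` a realisation.  In Pohlmann's eigen-weight dictionary (B. B. Gordon [Gordon1999HodgeAVSurvey]
9.2.2, White; tree): `dim Bᵖ(A) ⊗ ℂ − dim Dᵖ(A) ⊗ ℂ = #(pohlmannSets Φ p ∖ pohlmannDivisorSets Φ p)` — the balanced
`2p`-subsets `Δ ⊆ Hom(K, ℂ)` which are not disjoint unions of conjugate pairs; the cup product of two eigen-weight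
classes is the class of the disjoint union of the weights (tree `cupMonomial_cup_cupMonomial_of_disjoint`).  B. Moonen,
Yu. Zarhin [MoonenZarhin1998WeilClasses], proof of Criterion (Q2): the ring `D•(A)` of divisor classes consists of the
invariants of `Gdiv(A)`, and a class is exceptional iff `Gdiv` moves it — so **an exceptional class times a non-zero
divisor monomial on complementary coordinates stays exceptional**.  g46-#3 produced `4·C(w, 2)` exceptional WEIL
LINES of degree `m = g/4` (the coset-fibres of the biquadratic Weil CM subfields, `w = g + 1 − Rank(Φ)`).  THIS FILE
multiplies them by divisor monomials:

> **Mechanism** (any CM field, §1).  `union_mem_pohlmannSets` (a disjoint union of balanced sets is balanced),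
> `union_not_mem_pohlmannDivisorSets` (`Φ` primitive: an EXCEPTIONAL balanced set `Δ` joined with a disjoint
> conjugation-closed set `E` is exceptional — were `Δ ⊔ E` conjugation-closed, so would be `Δ`),
> `filter_union_eq_of_free` (if `Δ` is CONJUGATION-FREE, `Δ` is recovered from `Δ ⊔ E` as the members whose conjugate
> is missing — injectivity), `pairUnion_mem_pohlmannDivisorSets` (`E(Q) = Q ⊔ Q̄` for `Q ⊆ Φ` is a Pohlmann divisor set
> of degree `|Q|`), `card_freeComplement` (`#{φ ∈ Φ : φ, φ̄ ∉ Δ} = g − |Δ|` for conjugation-free `Δ`).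
> **Theorem** (`four_mul_choose_mul_choose_le_finrank_sub`, ★).  `[K:ℚ] = 8m`, `Φ` primitive, `A` any realisation, any
> `j`: **`dim B^{m+j}(A) − dim D^{m+j}(A) ≥ 4 · C([K:ℚ]/2 + 1 − Rank(Φ), 2) · C(2m, j)`** — each of the `4·C(w,2)`
> Weil lines `Δ` of g46-#3 (conjugation-free, `|Δ| = 2m`, blocking `2m` of the `4m` conjugate pairs) times each of the
> `C(2m, j)` divisor monomials on `j` of the `2m` free conjugate pairs gives a distinct exceptional class in
> `H^{2(m+j)}(A)`.  Variants `…_of_isSimple`, `…_of_twistStabilizer_eq_bot`.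
> **Theorem** (DEGREE `32`, `sixteenfold`).  Every SIMPLE DEGENERATE abelian `16`-fold with complex multiplication by `K`
> (`[K:ℚ] = 32`, rank `11`, `w = 6`): **`dim Bᵖ(A) − dim Dᵖ(A) ≥ 60·C(8, p − 4)`** for `4 ≤ p ≤ 12`
> (`sixty_mul_choose_le_finrank_sub_of_finrank_eq_thirtytwo`); in the MIDDLE cohomology **`dim B⁸(A) − dim D⁸(A) ≥ 4200`**
> (`fortyTwoHundred_le_finrank_sub_of_finrank_eq_thirtytwo`; gen 45: `≥ 12`), `dim B⁵ − dim D⁵ ≥ 480`, `dim B⁶ − dim D⁶ ≥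
> 1680`; existence `exists_isSimple_sixteenfold_fortyTwoHundred_of_finrank_eq_thirtytwo`.  (A census of the seat — not
> formalised — gives the exact middle value `33996` and `dim B⁴ − dim D⁴ = 1740`.)
> **Theorem** (DEGREE `64`, rank `17` primitive, e.g. near-bent): `dim B^{8+j} − dim D^{8+j} ≥ 480·C(16, j)`; middle
> degree `dim B¹⁶(A) − dim D¹⁶(A) ≥ 480·C(16,8) = 6 177 600`.

HONEST SCOPE.  Lower bounds by an explicit injective family; not all exceptional classes are of this form; the
algebraicity of any of these classes (the Hodge conjecture for these simple CM `16`- and `32`-folds) is OPEN and not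
addressed.  THEOREMS ONLY: no definition, no named fact, no instance, no `sorry`.

## References

* [MoonenZarhin1998WeilClasses] B. J. J. Moonen, Yu. G. Zarhin, *Weil classes on abelian varieties*, J. reine angew.
  Math. 496 (1998) 83–92: Criterion (Q2) and its proof (Lemma: `(⊕ ⋀ⁱ V)^{Gdiv} = D•(X)`), Remark (1).
* [Gordon1999HodgeAVSurvey] B. B. Gordon, *A survey of the Hodge conjecture for abelian varieties*, 9.2.2 (White's
  count), 5.13 (ii), §9.3.
* [Pohlmann1968] H. Pohlmann, Ann. of Math. 88 (1968), Thm. 1.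
* [vanGeemen1994HodgeAV] B. van Geemen, LNM 1594 (1994), §2.4–2.5 (the ring `D•`, exceptional classes), 4.7.
* [Dodson1984] B. Dodson, Trans. AMS 283 (1984), §3.1.1 Theorem, §3.2.1.
* [Shimura1998] G. Shimura, *Abelian Varieties with Complex Multiplication and Modular Functions*, §6.2 Thm. 3, §8.2
  Prop. 26.

## Provenance

Lane `lit-hodgefound` (Track 2, Layer A4/A5), seat `lit-hodgefound-p10` generation 46, row g46-#4; neighbours cited by
name, nothing restated: `MultiquadraticWeilSubfieldsClasses` (g46-#3: `image_coset_mem_pohlmannSets_diff`,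
`ncard_cosets_eq_four_mul`, `sixty_le_…`), `MultiquadraticWeilSubfields` (g46-#2: `ncard_indexFour_balanced_eq_choose_sub_cmTypeRank`),
`DivisorClassesCMType` (`pohlmannDivisorSets_eq_of_pairs`, `mem_disjointUnionsOf_succ_iff_union`, `pohlmannDivisorSets_subset_pohlmannSets`,
`IsGaloisBalanced.disjUnion`, `finrank_hodgeClassSpan_sub_finrank_divisorClassesSpan`), `NondegenerateCMTypeDivisorClasses`
(`mem_pohlmannSets_one_iff_of_isPrimitive`), `Multiquadratic` (degree-`32` facts), `MultiquadraticPrimitiveNearBent` (g45-#6).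
-/

open scoped BigOperators NumberField IsMulCommutative Classical
open NumberField Module CategoryTheory CategoryTheory.Limits IntermediateField

namespace Literature.AlgebraicGeometry.Pohlmann1968

namespace MultiquadraticWeilSubfieldsProducts

open scoped Literature.NumberTheory.ComplexMultiplication
open Literature.NumberTheory.ComplexMultiplication (twistStabilizer IsCMTypeWith conjGal IsPrimitive
  pattern_primitive_iff_twistStabilizer_eq_bot)
open Literature.AlgebraicGeometry.Pohlmann1968.MultiquadraticWeilSubfields
  (ncard_indexFour_balanced_eq_choose_sub_cmTypeRank)
open Literature.AlgebraicGeometry.Pohlmann1968.MultiquadraticWeilSubfieldsClasses (image_coset_mem_pohlmannSets_diff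
  ncard_cosets_eq_four_mul sixty_le_finrank_sub_of_finrank_eq_thirtytwo)
open Literature.AlgebraicGeometry.Pohlmann1968.Multiquadratic
  (cmTypeRank_eq_eleven_of_isSimple_of_not_isNondegenerate isSimple_iff_cmTypeRank_eq_eleven_or_seventeen
  exists_isPrimitive_cmTypeRank_eq_eleven)
open Literature.AlgebraicGeometry.Pohlmann1968.MultiquadraticPrimitiveNearBent
  (exists_isSimple_exceptional_nearBent_of_finrank_eq_sixtyFour)
open Literature.AlgebraicGeometry.Motives (CMType AbelianVariety)
open Literature.AlgebraicGeometry.HodgeTheory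
open Literature.AlgebraicGeometry.VanGeemen1994 (hodgeClassSpan)
open Literature.Barriers.HodgeConjecture (divisorClassesSpan)
open Literature.AlgebraicGeometry.ComplexMultiplication (IsCMTypeRealisation exists_isCMTypeRealisation
  isPrimitive_ringEquiv_complex_iff isSimple_iff_isPrimitive)

/-! ## §1 The mechanism: exceptional set ⊔ disjoint conjugation-closed set is exceptional; recovery; divisor blocks -/

section Mechanism

variable {K : Type} [Field K] [NumberField K] [IsCMField K] {Φ : CMType K}

omit [NumberField K] [IsCMField K] in
/-- `conj (conj φ) = φ`. [folklore] -/
private theorem conjugate_conjugate_pr (φ : K →+* ℂ) :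
    ComplexEmbedding.conjugate (ComplexEmbedding.conjugate φ) = φ := star_star φ

omit [NumberField K] [IsCMField K] in
/-- `φ ∈ Φ ⟹ φ̄ ∉ Φ`, `φ ∉ Φ ⟹ φ̄ ∈ Φ`. [cite: Shimura1998, §18.1] -/
private theorem conjugate_not_mem_pr {φ : K →+* ℂ} (h : φ ∈ Φ.1) : ComplexEmbedding.conjugate φ ∉ Φ.1 :=
  (Φ.2 φ).1 h

omit [NumberField K] [IsCMField K] in
/-- A member of `Φ` differs from every conjugate of a member of `Φ`. [cite: Shimura1998, §18.1] -/
private theorem ne_conjugate_pr {φ ψ : K →+* ℂ} (hφ : φ ∈ Φ.1) (hψ : ψ ∈ Φ.1) :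
    φ ≠ ComplexEmbedding.conjugate ψ := fun h => conjugate_not_mem_pr hψ (h ▸ hφ)

omit [NumberField K] [IsCMField K] in
/-- **A disjoint union of balanced sets is balanced**: `Δ ∈ P_p`, `E ∈ P_q`, `Δ ∩ E = ∅` ⟹ `Δ ∪ E ∈ P_{p+q}` (the class of
`Δ ⊔ E` is the cup product of the classes of `Δ` and `E`). [cite: Gordon1999HodgeAVSurvey, §9.2 (9.2.1) and 9.2.2] -/
theorem union_mem_pohlmannSets {Δ E : Finset (K →+* ℂ)} {p q : ℕ} (hΔ : Δ ∈ pohlmannSets Φ p)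
    (hE : E ∈ pohlmannSets Φ q) (hdisj : Disjoint Δ E) : Δ ∪ E ∈ pohlmannSets Φ (p + q) := by
  refine ⟨by rw [Finset.card_union_of_disjoint hdisj, hΔ.1, hE.1]; ring, ?_⟩
  have h := hΔ.2.disjUnion hE.2 hdisj
  rwa [Finset.disjUnion_eq_union] at h

/-- **EXCEPTIONAL ⊔ CONJUGATION-CLOSED IS EXCEPTIONAL** (`Φ` primitive, so that the Pohlmann divisor sets are the
conjugation-closed balanced sets): if `Δ ∈ P_p ∖ PD_p`, `E = Ē` and `Δ ∩ E = ∅`, then `Δ ∪ E` is in no `PD_n` — an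
exceptional class times a divisor monomial on other coordinates is exceptional (`Gdiv` moves it).
[cite: MoonenZarhin1998WeilClasses, Criterion (Q2) (proof) and Remark (1)] [cite: Gordon1999HodgeAVSurvey, 9.2.2] -/
theorem union_not_mem_pohlmannDivisorSets (φ₀ : K →+* ℂ) (hprim : IsPrimitive (ℂ ≃+* ℂ) Φ.1 φ₀)
    {Δ E : Finset (K →+* ℂ)} {p : ℕ} (hΔ : Δ ∈ pohlmannSets Φ p \ pohlmannDivisorSets Φ p)
    (hE : ∀ φ ∈ E, ComplexEmbedding.conjugate φ ∈ E) (hdisj : Disjoint Δ E) (n : ℕ) :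
    Δ ∪ E ∉ pohlmannDivisorSets Φ n := by
  have hpairs := mem_pohlmannSets_one_iff_of_isPrimitive φ₀ hprim (Φ := Φ)
  rw [pohlmannDivisorSets_eq_of_pairs hpairs n]
  rintro ⟨-, hclosed⟩
  apply hΔ.2
  rw [pohlmannDivisorSets_eq_of_pairs hpairs p]
  refine ⟨hΔ.1, fun φ hφ => ?_⟩
  rcases Finset.mem_union.1 (hclosed φ (Finset.mem_union_left E hφ)) with h | h
  · exact h
  · exfalso
    have h2 := hE _ h
    rw [conjugate_conjugate_pr] at h2
    exact Finset.disjoint_left.1 hdisj hφ h2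

omit [NumberField K] [IsCMField K] in
/-- **RECOVERY**: for a CONJUGATION-FREE `Δ` (`Δ ∩ Δ̄ = ∅`) and a conjugation-closed `E` disjoint from it, `Δ` is the set of
members of `Δ ∪ E` whose conjugate is not in `Δ ∪ E`. [folklore] -/
private theorem filter_union_eq_of_free {Δ E : Finset (K →+* ℂ)} (hfree : ∀ φ ∈ Δ, ComplexEmbedding.conjugate φ ∉ Δ)
    (hE : ∀ φ ∈ E, ComplexEmbedding.conjugate φ ∈ E) (hdisj : Disjoint Δ E) :
    (Δ ∪ E).filter (fun φ => ComplexEmbedding.conjugate φ ∉ Δ ∪ E) = Δ := by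
  ext φ
  simp only [Finset.mem_filter, Finset.mem_union, not_or]
  constructor
  · rintro ⟨hφ | hφ, h1, h2⟩
    · exact hφ
    · exact absurd (hE φ hφ) h2
  · intro hφ
    refine ⟨Or.inl hφ, hfree φ hφ, fun h => ?_⟩
    have h2 := hE _ h
    rw [conjugate_conjugate_pr] at h2
    exact Finset.disjoint_left.1 hdisj hφ h2

omit [NumberField K] [IsCMField K] in
/-- … and `E` is the rest. [folklore] -/
private theorem sdiff_union_eq_of_disjoint {Δ E : Finset (K →+* ℂ)} (hdisj : Disjoint Δ E) : (Δ ∪ E) \ Δ = E := by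
  rw [Finset.union_sdiff_left, Finset.sdiff_eq_self_iff_disjoint]
  exact hdisj.symm

/-- **The divisor block `E(Q) = Q ⊔ Q̄`** of a set `Q ⊆ Φ` is a disjoint union of `|Q|` conjugate pairs, i.e. a Pohlmann
divisor set of degree `|Q|` (`Φ` primitive: balanced pairs = conjugate pairs). [cite: Gordon1999HodgeAVSurvey, 9.2.2]
[cite: vanGeemen1994HodgeAV, §2.4] -/
theorem pairUnion_mem_pohlmannDivisorSets (φ₀ : K →+* ℂ) (hprim : IsPrimitive (ℂ ≃+* ℂ) Φ.1 φ₀)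
    (Q : Finset (K →+* ℂ)) (hQ : ∀ φ ∈ Q, φ ∈ Φ.1) :
    Q ∪ Q.image ComplexEmbedding.conjugate ∈ pohlmannDivisorSets Φ Q.card := by
  have hpairs := mem_pohlmannSets_one_iff_of_isPrimitive φ₀ hprim (Φ := Φ)
  induction Q using Finset.induction_on with
  | empty => simp [pohlmannDivisorSets_def]
  | insert a Q ha ih =>
    have hQ' : ∀ φ ∈ Q, φ ∈ Φ.1 := fun φ hφ => hQ φ (Finset.mem_insert_of_mem hφ)
    have haΦ : a ∈ Φ.1 := hQ a (Finset.mem_insert_self a Q)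
    rw [Finset.card_insert_of_notMem ha, pohlmannDivisorSets_def, mem_disjointUnionsOf_succ_iff_union]
    refine ⟨Q ∪ Q.image ComplexEmbedding.conjugate, (pohlmannDivisorSets_def Φ Q.card) ▸ ih hQ',
      {a, ComplexEmbedding.conjugate a}, (hpairs _).2 ⟨a, rfl⟩, ?_, ?_⟩
    · rw [Finset.disjoint_left]
      intro φ hφ hφa
      rw [Finset.mem_insert, Finset.mem_singleton] at hφa
      rcases Finset.mem_union.1 hφ with h | h
      · rcases hφa with rfl | rfl
        · exact ha h
        · exact conjugate_not_mem_pr haΦ (hQ' _ h)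
      · obtain ⟨ψ, hψ, rfl⟩ := Finset.mem_image.1 h
        rcases hφa with e | e
        · exact ne_conjugate_pr haΦ (hQ' ψ hψ) e.symm
        · exact ha (star_injective e ▸ hψ)
    · ext φ
      simp only [Finset.mem_union, Finset.mem_insert, Finset.mem_image, Finset.mem_singleton]
      constructor
      · rintro ((rfl | h) | ⟨ψ, (rfl | hψ), rfl⟩)
        · exact Or.inr (Or.inl rfl)
        · exact Or.inl (Or.inl h)
        · exact Or.inr (Or.inr rfl)
        · exact Or.inl (Or.inr ⟨ψ, hψ, rfl⟩)
      · rintro ((h | ⟨ψ, hψ, rfl⟩) | (rfl | rfl))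
        · exact Or.inl (Or.inr h)
        · exact Or.inr ⟨ψ, Or.inr hψ, rfl⟩
        · exact Or.inl (Or.inl rfl)
        · exact Or.inr ⟨a, Or.inl rfl, rfl⟩

omit [NumberField K] [IsCMField K] in
/-- `|Q ⊔ Q̄| = 2|Q|` for `Q ⊆ Φ`. [folklore] -/
private theorem card_pairUnion {Q : Finset (K →+* ℂ)} (hQ : ∀ φ ∈ Q, φ ∈ Φ.1) :
    (Q ∪ Q.image ComplexEmbedding.conjugate).card = 2 * Q.card := by
  have hdisj : Disjoint Q (Q.image ComplexEmbedding.conjugate) := by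
    rw [Finset.disjoint_left]
    rintro φ hφ h
    obtain ⟨ψ, hψ, e⟩ := Finset.mem_image.1 h
    exact ne_conjugate_pr (hQ φ hφ) (hQ ψ hψ) e.symm
  rw [Finset.card_union_of_disjoint hdisj, Finset.card_image_of_injective _ star_injective]; ring

omit [NumberField K] [IsCMField K] in
/-- `Q ⊔ Q̄` is conjugation-closed. [folklore] -/
private theorem conjugate_mem_pairUnion {Q : Finset (K →+* ℂ)} {φ : K →+* ℂ}
    (hφ : φ ∈ Q ∪ Q.image ComplexEmbedding.conjugate) :
    ComplexEmbedding.conjugate φ ∈ Q ∪ Q.image ComplexEmbedding.conjugate := by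
  rcases Finset.mem_union.1 hφ with h | h
  · exact Finset.mem_union_right _ (Finset.mem_image_of_mem _ h)
  · obtain ⟨ψ, hψ, rfl⟩ := Finset.mem_image.1 h
    rw [conjugate_conjugate_pr]
    exact Finset.mem_union_left _ hψ

omit [NumberField K] [IsCMField K] in
/-- `Q` is recovered from `Q ⊔ Q̄` as its members in `Φ`. [folklore] -/
private theorem filter_pairUnion_eq {Q : Finset (K →+* ℂ)} (hQ : ∀ φ ∈ Q, φ ∈ Φ.1) :
    (Q ∪ Q.image ComplexEmbedding.conjugate).filter (fun φ => φ ∈ Φ.1) = Q := by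
  ext φ
  simp only [Finset.mem_filter, Finset.mem_union, Finset.mem_image]
  constructor
  · rintro ⟨h | ⟨ψ, hψ, rfl⟩, hΦ⟩
    · exact h
    · exact absurd hΦ (conjugate_not_mem_pr (hQ ψ hψ))
  · exact fun h => ⟨Or.inl h, hQ φ h⟩

omit [IsCMField K] in
/-- **The free conjugate pairs**: for a conjugation-free `Δ`, `#{φ ∈ Φ : φ ∉ Δ, φ̄ ∉ Δ} = [K:ℚ]/2 − |Δ|` (each member of
`Δ` blocks the pair it lies in). [cite: Gordon1999HodgeAVSurvey, 9.2.2] -/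
theorem card_freeComplement {Δ : Finset (K →+* ℂ)} (hfree : ∀ φ ∈ Δ, ComplexEmbedding.conjugate φ ∉ Δ) :
    (Finset.univ.filter fun φ : K →+* ℂ => φ ∈ Φ.1 ∧ φ ∉ Δ ∧ ComplexEmbedding.conjugate φ ∉ Δ).card =
      finrank ℚ K / 2 - Δ.card := by
  -- the representative in `Φ` of the pair of `φ`
  set r : (K →+* ℂ) → (K →+* ℂ) := fun φ => if φ ∈ Φ.1 then φ else ComplexEmbedding.conjugate φ with hr
  have hr1 : ∀ φ, φ ∈ Φ.1 → r φ = φ := fun φ h => if_pos h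
  have hr2 : ∀ φ, φ ∉ Φ.1 → r φ = ComplexEmbedding.conjugate φ := fun φ h => if_neg h
  have hrΦ : ∀ φ, r φ ∈ Φ.1 := fun φ => by
    by_cases h : φ ∈ Φ.1
    · rw [hr1 φ h]; exact h
    · rw [hr2 φ h]
      by_contra hc
      exact h ((Φ.2 φ).2 hc)
  have hinj : Set.InjOn r ↑Δ := by
    intro φ hφ ψ hψ h
    rw [Finset.mem_coe] at hφ hψ
    by_cases h1 : φ ∈ Φ.1 <;> by_cases h2 : ψ ∈ Φ.1
    · rwa [hr1 φ h1, hr1 ψ h2] at h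
    · rw [hr1 φ h1, hr2 ψ h2] at h
      rw [h] at hφ
      exact absurd hφ (hfree ψ hψ)
    · rw [hr2 φ h1, hr1 ψ h2] at h
      rw [← h] at hψ
      exact absurd hψ (hfree φ hφ)
    · rw [hr2 φ h1, hr2 ψ h2] at h
      exact star_injective h
  have hset : (Finset.univ.filter fun φ : K →+* ℂ => φ ∈ Φ.1 ∧ φ ∉ Δ ∧ ComplexEmbedding.conjugate φ ∉ Δ) =
      (Finset.univ.filter fun φ : K →+* ℂ => φ ∈ Φ.1) \ Δ.image r := by
    ext φ
    simp only [Finset.mem_filter, Finset.mem_univ, true_and, Finset.mem_sdiff, Finset.mem_image, not_exists, not_and]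
    constructor
    · rintro ⟨hΦ, h1, h2⟩
      refine ⟨hΦ, fun δ hδ hδφ => ?_⟩
      by_cases hδΦ : δ ∈ Φ.1
      · rw [hr1 δ hδΦ] at hδφ; exact h1 (hδφ ▸ hδ)
      · rw [hr2 δ hδΦ] at hδφ
        apply h2; rw [← hδφ, conjugate_conjugate_pr]; exact hδ
    · rintro ⟨hΦ, h⟩
      refine ⟨hΦ, fun hφ => h φ hφ (hr1 φ hΦ), fun hφ => h _ hφ ?_⟩
      rw [hr2 _ (conjugate_not_mem_pr hΦ), conjugate_conjugate_pr]
  have hsub : Δ.image r ⊆ Finset.univ.filter fun φ : K →+* ℂ => φ ∈ Φ.1 := by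
    intro φ hφ
    obtain ⟨δ, -, rfl⟩ := Finset.mem_image.1 hφ
    simpa using hrΦ δ
  have hg : (Finset.univ.filter fun φ : K →+* ℂ => φ ∈ Φ.1).card = finrank ℚ K / 2 := by
    have h := Literature.AlgebraicGeometry.Motives.HodgeStructure.two_mul_ncard_cmType_eq_finrank Φ
    have e : Φ.1.ncard = (Finset.univ.filter fun φ : K →+* ℂ => φ ∈ Φ.1).card := by
      rw [← Set.ncard_coe_finset]; congr 1; ext φ; simp
    omega
  rw [hset, Finset.card_sdiff_of_subset hsub, hg, Finset.card_image_of_injOn hinj]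

end Mechanism

/-! ## §2 ★ The count: Weil lines of the biquadratic Weil subfields times divisor monomials -/

section Count

variable {K : Type} [Field K] [NumberField K] [IsCMField K] [IsGalois ℚ K]
  {A : AbelianVariety ℂ} {ι : 𝓞 K →+* End A} {θ : K →+* Module.End ℂ (complexBetti A.X 1)}

omit [IsGalois ℚ K] in
/-- `φ₀ ∘ ρ = conj ∘ φ₀`. [cite: Shimura1998, §18.2 Lemma (i)] -/
private theorem apply_conjGal_eq_pr (φ₀ : K →+* ℂ) (x : K) :
    φ₀ ((conjGal : K ≃ₐ[ℚ] K) x) = starRingEnd ℂ (φ₀ x) :=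
  AbelianCMFieldExistence.apply_conjGal_eq φ₀ x

omit [IsCMField K] [IsGalois ℚ K] in
/-- `g⁻¹ = g` in exponent `2`. [folklore] -/
private theorem inv_eq_self_pr (hexp : ∀ g : K ≃ₐ[ℚ] K, g ^ 2 = 1) (g : K ≃ₐ[ℚ] K) : g⁻¹ = g :=
  inv_eq_of_mul_eq_one_right (by rw [← pow_two]; exact hexp g)

/-- `σ_{ρt} = σ̄_t`. [cite: Shimura1998, §18.2 Lemma (i)] -/
private theorem embOf_conjGal_mul_pr (hexp : ∀ g : K ≃ₐ[ℚ] K, g ^ 2 = 1) (φ₀ : K →+* ℂ) (x : K ≃ₐ[ℚ] K) :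
    embOf φ₀ ((conjGal : K ≃ₐ[ℚ] K) * x) = ComplexEmbedding.conjugate (embOf φ₀ x) := by
  haveI := Multiquadratic.isAbelianGalois_of_forall_sq_eq_one hexp
  refine RingHom.ext fun y => ?_
  rw [embOf_apply, ComplexEmbedding.conjugate_coe_eq, embOf_apply]
  have e : ((conjGal : K ≃ₐ[ℚ] K) * x).symm y = (conjGal : K ≃ₐ[ℚ] K) (x.symm y) := by
    rw [mul_comm, ← AlgEquiv.aut_inv, mul_inv_rev, inv_eq_self_pr hexp conjGal, AlgEquiv.mul_apply,
      AlgEquiv.aut_inv]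
  rw [e, apply_conjGal_eq_pr]

/-- **The coset-fibres of `H ∌ ρ` are conjugation-free** (`σ̄_t = σ_{ρt}` and `ρ ∉ H`). [cite: Shimura1998, §18.2 Lemma (i)]
[cite: Gordon1999HodgeAVSurvey, 9.2.2 (a)] -/
theorem conjugate_not_mem_image_coset (hexp : ∀ g : K ≃ₐ[ℚ] K, g ^ 2 = 1) (φ₀ : K →+* ℂ) {H : Subgroup (K ≃ₐ[ℚ] K)}
    (hρ : (conjGal : K ≃ₐ[ℚ] K) ∉ H) (x : K ≃ₐ[ℚ] K) :
    ∀ φ ∈ (Finset.univ.filter fun t : K ≃ₐ[ℚ] K => x * t ∈ H).image (embOf φ₀),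
      ComplexEmbedding.conjugate φ ∉ (Finset.univ.filter fun t : K ≃ₐ[ℚ] K => x * t ∈ H).image (embOf φ₀) := by
  haveI := Multiquadratic.isAbelianGalois_of_forall_sq_eq_one hexp
  intro φ hφ hφ'
  simp only [Finset.mem_image, Finset.mem_filter, Finset.mem_univ, true_and] at hφ hφ'
  obtain ⟨t, ht, rfl⟩ := hφ
  obtain ⟨t', ht', h⟩ := hφ'
  rw [← embOf_conjGal_mul_pr hexp] at h
  have e : t' = conjGal * t := (embOf_bijective φ₀).1 h
  rw [e] at ht'
  apply hρ
  have e2 : (conjGal : K ≃ₐ[ℚ] K) = (x * (conjGal * t)) * (x * t)⁻¹ := by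
    rw [mul_left_comm, mul_inv_cancel_right]
  rw [e2]
  exact H.mul_mem ht' (H.inv_mem ht)

omit [IsCMField K] in
/-- `|σ(xH)| = |H| = [K:ℚ]/4` for `H` of index `4`. [cite: Shimura1998, §8.1] -/
theorem card_image_coset (φ₀ : K →+* ℂ) {H : Subgroup (K ≃ₐ[ℚ] K)} (hH : H.index = 4) (x : K ≃ₐ[ℚ] K) :
    ((Finset.univ.filter fun t : K ≃ₐ[ℚ] K => x * t ∈ H).image (embOf φ₀)).card = finrank ℚ K / 4 := by
  rw [Finset.card_image_of_injective _ (embOf_bijective φ₀).1]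
  have hc : (Finset.univ.filter fun t : K ≃ₐ[ℚ] K => x * t ∈ H).card = Nat.card H := by
    have e : Nat.card H = (Finset.univ.filter fun g : K ≃ₐ[ℚ] K => g ∈ H).card := by
      rw [Nat.card_eq_fintype_card, ← Fintype.card_subtype]
    rw [e]
    refine Finset.card_bij (fun u _ => x * u) (fun u hu => ?_) (fun a _ b _ hab => mul_left_cancel hab)
      (fun k hk => ⟨x⁻¹ * k, ?_, by rw [mul_inv_cancel_left]⟩)
    · simpa using hu
    · simpa using hk
  rw [hc]
  have h := H.card_mul_index
  rw [hH, Nat.card_eq_fintype_card (α := K ≃ₐ[ℚ] K), card_gal_eq_finrank φ₀] at h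
  omega

/-- **★ `dim B^{m+j}(A) − dim D^{m+j}(A) ≥ 4·C([K:ℚ]/2 + 1 − Rank(Φ), 2)·C(2m, j)`, `8m = [K:ℚ]`, FOR EVERY REALISATION OF A
PRIMITIVE CM TYPE OF A MULTIQUADRATIC CM FIELD** and every `j`: each of the `4·C(w, 2)` exceptional Weil lines `Δ` of the
biquadratic Weil CM subfields (conjugation-free balanced `2m`-sets, g46-#3) times each divisor monomial on `j` of the
`2m` conjugate pairs free of `Δ` is a distinct exceptional class in `H^{2(m+j)}(A)`.
[cite: MoonenZarhin1998WeilClasses, Criterion (Q2) (proof) and Remark (1)] [cite: Gordon1999HodgeAVSurvey, 9.2.2 and 5.13 (ii)]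
[cite: Pohlmann1968, Thm. 1] [cite: Dodson1984, §3.1.1 Theorem] -/
theorem four_mul_choose_mul_choose_le_finrank_sub (hexp : ∀ g : K ≃ₐ[ℚ] K, g ^ 2 = 1) (φ₀ : K →+* ℂ)
    (Φ : CMType K) (hprim : IsPrimitive (ℂ ≃+* ℂ) Φ.1 φ₀) {m : ℕ} (hm : finrank ℚ K = 8 * m)
    (hA : IsCMTypeRealisation Φ A ι θ) (j : ℕ) :
    4 * Nat.choose (finrank ℚ K / 2 + 1 - cmTypeRank Φ) 2 * Nat.choose (2 * m) j ≤
      Module.finrank ℂ ↥(hodgeClassSpan (finrank ℚ K / 2) A.X (m + j)) -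
        Module.finrank ℂ ↥(divisorClassesSpan A.X (finrank ℚ K / 2) (m + j)) := by
  haveI := Multiquadratic.isAbelianGalois_of_forall_sq_eq_one hexp
  rw [finrank_hodgeClassSpan_sub_finrank_divisorClassesSpan hA (m + j),
    ← ncard_indexFour_balanced_eq_choose_sub_cmTypeRank hexp φ₀ Φ, ← ncard_cosets_eq_four_mul hexp]
  have hm8 : finrank ℚ K / 8 = m := by rw [hm]; omega
  have hm4 : finrank ℚ K / 4 = 2 * m := by rw [hm]; omega
  have hm2 : finrank ℚ K / 2 = 4 * m := by rw [hm]; omega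
  -- the coset family (a finite set of finsets of `Gal(K/ℚ)`)
  set 𝒞 : Set (Finset (K ≃ₐ[ℚ] K)) := {C | ∃ H : Subgroup (K ≃ₐ[ℚ] K), H.index = 4 ∧
      ((conjGal : K ≃ₐ[ℚ] K) ∉ H ∧ ∀ x : K ≃ₐ[ℚ] K, 2 * ((Finset.univ.filter fun s : K ≃ₐ[ℚ] K =>
        embOf φ₀ s ∈ Φ.1).filter fun t => x * t ∈ H).card = Nat.card H) ∧
      ∃ x : K ≃ₐ[ℚ] K, C = Finset.univ.filter fun t : K ≃ₐ[ℚ] K => x * t ∈ H} with h𝒞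
  -- the Weil line of a coset and its free pairs
  set Δ : Finset (K ≃ₐ[ℚ] K) → Finset (K →+* ℂ) := fun C => C.image (embOf φ₀) with hΔ
  set S : Finset (K ≃ₐ[ℚ] K) → Finset (K →+* ℂ) := fun C =>
    Finset.univ.filter fun φ : K →+* ℂ => φ ∈ Φ.1 ∧ φ ∉ Δ C ∧ ComplexEmbedding.conjugate φ ∉ Δ C with hS
  set U : Finset (K ≃ₐ[ℚ] K) → Finset (K →+* ℂ) → Finset (K →+* ℂ) := fun C Q =>
    Δ C ∪ (Q ∪ Q.image ComplexEmbedding.conjugate) with hU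
  -- facts about a member of the family
  have hfacts : ∀ C ∈ 𝒞, Δ C ∈ pohlmannSets Φ m \ pohlmannDivisorSets Φ m ∧
      (∀ φ ∈ Δ C, ComplexEmbedding.conjugate φ ∉ Δ C) ∧ (S C).card = 2 * m := by
    rintro C ⟨H, hH, ⟨hρ, hbal⟩, x, rfl⟩
    have h1 : Δ _ ∈ _ := hm8 ▸ image_coset_mem_pohlmannSets_diff hexp φ₀ Φ hprim hH hρ hbal x
    have hfree := conjugate_not_mem_image_coset hexp φ₀ hρ x
    refine ⟨h1, hfree, ?_⟩
    show (Finset.univ.filter fun φ : K →+* ℂ => φ ∈ Φ.1 ∧ φ ∉ Δ _ ∧ ComplexEmbedding.conjugate φ ∉ Δ _).card = 2 * m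
    rw [card_freeComplement hfree]
    show finrank ℚ K / 2 - ((Finset.univ.filter fun t : K ≃ₐ[ℚ] K => x * t ∈ H).image (embOf φ₀)).card = 2 * m
    rw [card_image_coset φ₀ hH x, hm2, hm4]; omega
  -- `U C Q` is exceptional of degree `m + j`
  have hUmem : ∀ C ∈ 𝒞, ∀ Q ∈ (S C).powersetCard j, U C Q ∈ pohlmannSets Φ (m + j) \ pohlmannDivisorSets Φ (m + j) := by
    intro C hC Q hQ
    obtain ⟨hΔC, hfree, -⟩ := hfacts C hC
    rw [Finset.mem_powersetCard] at hQ
    have hQS : ∀ φ ∈ Q, φ ∈ Φ.1 ∧ φ ∉ Δ C ∧ ComplexEmbedding.conjugate φ ∉ Δ C := fun φ hφ => by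
      have := hQ.1 hφ; simpa [hS] using this
    have hQΦ : ∀ φ ∈ Q, φ ∈ Φ.1 := fun φ hφ => (hQS φ hφ).1
    have hdisj : Disjoint (Δ C) (Q ∪ Q.image ComplexEmbedding.conjugate) := by
      rw [Finset.disjoint_right]
      intro φ hφ
      rcases Finset.mem_union.1 hφ with h | h
      · exact (hQS φ h).2.1
      · obtain ⟨ψ, hψ, rfl⟩ := Finset.mem_image.1 h
        exact (hQS ψ hψ).2.2
    have hE : Q ∪ Q.image ComplexEmbedding.conjugate ∈ pohlmannSets Φ j := by
      have := pohlmannDivisorSets_subset_pohlmannSets Φ Q.card (pairUnion_mem_pohlmannDivisorSets φ₀ hprim Q hQΦ)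
      rwa [hQ.2] at this
    exact ⟨union_mem_pohlmannSets hΔC.1 hE hdisj,
      union_not_mem_pohlmannDivisorSets φ₀ hprim hΔC (fun φ hφ => conjugate_mem_pairUnion hφ) hdisj _⟩
  -- recovery: `Δ C` and `Q` from `U C Q`
  have hrecΔ : ∀ C ∈ 𝒞, ∀ Q ∈ (S C).powersetCard j,
      (U C Q).filter (fun φ => ComplexEmbedding.conjugate φ ∉ U C Q) = Δ C := by
    intro C hC Q hQ
    obtain ⟨-, hfree, -⟩ := hfacts C hC
    rw [Finset.mem_powersetCard] at hQ
    have hQS : ∀ φ ∈ Q, φ ∈ Φ.1 ∧ φ ∉ Δ C ∧ ComplexEmbedding.conjugate φ ∉ Δ C := fun φ hφ => by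
      have := hQ.1 hφ; simpa [hS] using this
    have hdisj : Disjoint (Δ C) (Q ∪ Q.image ComplexEmbedding.conjugate) := by
      rw [Finset.disjoint_right]
      intro φ hφ
      rcases Finset.mem_union.1 hφ with h | h
      · exact (hQS φ h).2.1
      · obtain ⟨ψ, hψ, rfl⟩ := Finset.mem_image.1 h
        exact (hQS ψ hψ).2.2
    exact filter_union_eq_of_free hfree (fun φ hφ => conjugate_mem_pairUnion hφ) hdisj
  have hrecQ : ∀ C ∈ 𝒞, ∀ Q ∈ (S C).powersetCard j,
      ((U C Q) \ Δ C).filter (fun φ => φ ∈ Φ.1) = Q := by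
    intro C hC Q hQ
    rw [Finset.mem_powersetCard] at hQ
    have hQS : ∀ φ ∈ Q, φ ∈ Φ.1 ∧ φ ∉ Δ C ∧ ComplexEmbedding.conjugate φ ∉ Δ C := fun φ hφ => by
      have := hQ.1 hφ; simpa [hS] using this
    have hdisj : Disjoint (Δ C) (Q ∪ Q.image ComplexEmbedding.conjugate) := by
      rw [Finset.disjoint_right]
      intro φ hφ
      rcases Finset.mem_union.1 hφ with h | h
      · exact (hQS φ h).2.1
      · obtain ⟨ψ, hψ, rfl⟩ := Finset.mem_image.1 h
        exact (hQS ψ hψ).2.2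
    show ((Δ C ∪ (Q ∪ Q.image ComplexEmbedding.conjugate)) \ Δ C).filter (fun φ => φ ∈ Φ.1) = Q
    rw [sdiff_union_eq_of_disjoint hdisj]
    exact filter_pairUnion_eq fun φ hφ => (hQS φ hφ).1
  -- the family as a finite union
  have h𝒞fin : 𝒞.Finite := Set.toFinite _
  set 𝒞f : Finset (Finset (K ≃ₐ[ℚ] K)) := h𝒞fin.toFinset with h𝒞f
  have hmem𝒞f : ∀ {C}, C ∈ 𝒞f ↔ C ∈ 𝒞 := by intro C; exact Set.Finite.mem_toFinset h𝒞fin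
  set F : Finset (K ≃ₐ[ℚ] K) → Finset (Finset (K →+* ℂ)) := fun C => ((S C).powersetCard j).image (U C) with hF
  have hdisjF : (↑𝒞f : Set (Finset (K ≃ₐ[ℚ] K))).PairwiseDisjoint F := by
    intro C hC C' hC' hne
    rw [Function.onFun, Finset.disjoint_left]
    intro V hV hV'
    simp only [hF, Finset.mem_image] at hV hV'
    obtain ⟨Q, hQ, rfl⟩ := hV
    obtain ⟨Q', hQ', hUU⟩ := hV'
    have hC𝒞 : C ∈ 𝒞 := hmem𝒞f.1 hC
    have hC'𝒞 : C' ∈ 𝒞 := hmem𝒞f.1 hC'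
    have hΔeq : Δ C' = Δ C := by
      rw [← hrecΔ C hC𝒞 Q hQ, ← hrecΔ C' hC'𝒞 Q' hQ', hUU]
    have hinj : Function.Injective fun C : Finset (K ≃ₐ[ℚ] K) => C.image (embOf φ₀) := by
      intro C₁ C₂ h
      have h' : (embOf φ₀) '' (↑C₁ : Set (K ≃ₐ[ℚ] K)) = (embOf φ₀) '' ↑C₂ := by
        rw [← Finset.coe_image, ← Finset.coe_image]; exact congrArg _ h
      exact Finset.coe_inj.1 ((embOf_bijective φ₀).1.image_injective h')
    exact hne (hinj hΔeq).symm
  have hcardF : ∀ C ∈ 𝒞f, (F C).card = Nat.choose (2 * m) j := by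
    intro C hC
    have hC𝒞 : C ∈ 𝒞 := hmem𝒞f.1 hC
    obtain ⟨-, -, hScard⟩ := hfacts C hC𝒞
    rw [hF, Finset.card_image_of_injOn, Finset.card_powersetCard, hScard]
    intro Q hQ Q' hQ' hQQ'
    have h1 := hrecQ C hC𝒞 Q hQ
    have h2 := hrecQ C hC𝒞 Q' hQ'
    rw [← h1, ← h2]
    exact congrArg (fun V => (V \ Δ C).filter fun φ => φ ∈ Φ.1) hQQ'
  have hsub : (↑(𝒞f.biUnion F) : Set (Finset (K →+* ℂ))) ⊆ pohlmannSets Φ (m + j) \ pohlmannDivisorSets Φ (m + j) := by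
    intro V hV
    rw [Finset.mem_coe, Finset.mem_biUnion] at hV
    obtain ⟨C, hC, hV⟩ := hV
    simp only [hF, Finset.mem_image] at hV
    obtain ⟨Q, hQ, rfl⟩ := hV
    exact hUmem C (hmem𝒞f.1 hC) Q hQ
  have hcount : (𝒞f.biUnion F).card = 𝒞.ncard * Nat.choose (2 * m) j := by
    rw [Finset.card_biUnion hdisjF, Finset.sum_congr rfl hcardF, Finset.sum_const, smul_eq_mul,
      Set.ncard_eq_toFinset_card 𝒞 h𝒞fin]
  calc 𝒞.ncard * Nat.choose (2 * m) j = (↑(𝒞f.biUnion F) : Set (Finset (K →+* ℂ))).ncard := by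
        rw [Set.ncard_coe_finset, hcount]
    _ ≤ (pohlmannSets Φ (m + j) \ pohlmannDivisorSets Φ (m + j)).ncard := Set.ncard_le_ncard hsub (Set.toFinite _)

/-- The same for a SIMPLE abelian variety of type `(K; Φ)`. [cite: Shimura1998, §8.2 Prop. 26]
[cite: MoonenZarhin1998WeilClasses, Criterion (Q2)] -/
theorem four_mul_choose_mul_choose_le_finrank_sub_of_isSimple (hexp : ∀ g : K ≃ₐ[ℚ] K, g ^ 2 = 1) (Φ : CMType K)
    {m : ℕ} (hm : finrank ℚ K = 8 * m) (hA : IsCMTypeRealisation Φ A ι θ) (hs : A.IsSimple) (j : ℕ) :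
    4 * Nat.choose (finrank ℚ K / 2 + 1 - cmTypeRank Φ) 2 * Nat.choose (2 * m) j ≤
      Module.finrank ℂ ↥(hodgeClassSpan (finrank ℚ K / 2) A.X (m + j)) -
        Module.finrank ℂ ↥(divisorClassesSpan A.X (finrank ℚ K / 2) (m + j)) := by
  obtain ⟨φ₀⟩ := (inferInstance : Nonempty (K →+* ℂ))
  exact four_mul_choose_mul_choose_le_finrank_sub hexp φ₀ Φ ((isSimple_iff_isPrimitive hA φ₀).1 hs) hm hA j

/-- The same for a CM type with TRIVIAL TWIST STABILISER. [cite: Shimura1998, §8.2 Prop. 26]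
[cite: MoonenZarhin1998WeilClasses, Criterion (Q2)] -/
theorem four_mul_choose_mul_choose_le_finrank_sub_of_twistStabilizer_eq_bot (hexp : ∀ g : K ≃ₐ[ℚ] K, g ^ 2 = 1)
    (Φ : CMType K) (hbot : twistStabilizer Φ = ⊥) {m : ℕ} (hm : finrank ℚ K = 8 * m)
    (hA : IsCMTypeRealisation Φ A ι θ) (j : ℕ) :
    4 * Nat.choose (finrank ℚ K / 2 + 1 - cmTypeRank Φ) 2 * Nat.choose (2 * m) j ≤
      Module.finrank ℂ ↥(hodgeClassSpan (finrank ℚ K / 2) A.X (m + j)) -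
        Module.finrank ℂ ↥(divisorClassesSpan A.X (finrank ℚ K / 2) (m + j)) := by
  obtain ⟨φ₀⟩ := (inferInstance : Nonempty (K →+* ℂ))
  exact four_mul_choose_mul_choose_le_finrank_sub hexp φ₀ Φ
    ((isPrimitive_ringEquiv_complex_iff Φ φ₀).2 ((pattern_primitive_iff_twistStabilizer_eq_bot Φ).2 hbot)) hm hA j

end Count

/-! ## §3 Degree `32`: the simple degenerate CM `16`-folds -/

section ThirtyTwo

variable {K : Type} [Field K] [NumberField K] [IsCMField K] [IsGalois ℚ K]
  {A : AbelianVariety ℂ} {ι : 𝓞 K →+* End A} {θ : K →+* Module.End ℂ (complexBetti A.X 1)}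

/-- **`[K:ℚ] = 32`: `dim B^{4+j}(A) − dim D^{4+j}(A) ≥ 60·C(8, j)` FOR EVERY SIMPLE DEGENERATE ABELIAN `16`-FOLD WITH
COMPLEX MULTIPLICATION BY `K`** (rank `11`, fifteen biquadratic Weil subfields, sixty Weil lines in `H⁸`, `C(8, j)`
divisor monomials on the eight free conjugate pairs). [cite: MoonenZarhin1998WeilClasses, Criterion (Q2) (proof)]
[cite: Gordon1999HodgeAVSurvey, 9.2.2] [cite: Dodson1984, §3.1.1 Theorem and §3.2.1] -/
theorem sixty_mul_choose_le_finrank_sub_of_finrank_eq_thirtytwo (hexp : ∀ g : K ≃ₐ[ℚ] K, g ^ 2 = 1)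
    (h32 : finrank ℚ K = 32) (Φ : CMType K) (hA : IsCMTypeRealisation Φ A ι θ) (hs : A.IsSimple)
    (hnd : ¬ IsNondegenerate Φ) (j : ℕ) :
    60 * Nat.choose 8 j ≤ Module.finrank ℂ ↥(hodgeClassSpan (finrank ℚ K / 2) A.X (4 + j)) -
        Module.finrank ℂ ↥(divisorClassesSpan A.X (finrank ℚ K / 2) (4 + j)) := by
  have h := four_mul_choose_mul_choose_le_finrank_sub_of_isSimple hexp Φ (m := 4) (by rw [h32]) hA hs j
  have hr := cmTypeRank_eq_eleven_of_isSimple_of_not_isNondegenerate hexp h32 Φ hA hs hnd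
  have e : 4 * Nat.choose (finrank ℚ K / 2 + 1 - cmTypeRank Φ) 2 = 60 := by rw [hr, h32]; decide
  rw [e] at h
  exact h

/-- **`[K:ℚ] = 32`, MIDDLE COHOMOLOGY: `dim B⁸(A) − dim D⁸(A) ≥ 4200 = 60·C(8,4)`** for every simple degenerate abelian
`16`-fold with complex multiplication by `K` (gen 45: `≥ 12`). [cite: MoonenZarhin1998WeilClasses, Criterion (Q2) (proof)]
[cite: Gordon1999HodgeAVSurvey, 9.2.2 and 5.13 (ii)] [cite: Pohlmann1968, Thm. 1] -/
theorem fortyTwoHundred_le_finrank_sub_of_finrank_eq_thirtytwo (hexp : ∀ g : K ≃ₐ[ℚ] K, g ^ 2 = 1)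
    (h32 : finrank ℚ K = 32) (Φ : CMType K) (hA : IsCMTypeRealisation Φ A ι θ) (hs : A.IsSimple)
    (hnd : ¬ IsNondegenerate Φ) :
    4200 ≤ Module.finrank ℂ ↥(hodgeClassSpan (finrank ℚ K / 2) A.X 8) -
        Module.finrank ℂ ↥(divisorClassesSpan A.X (finrank ℚ K / 2) 8) := by
  have h := sixty_mul_choose_le_finrank_sub_of_finrank_eq_thirtytwo hexp h32 Φ hA hs hnd 4
  have e : 60 * Nat.choose 8 4 = 4200 := by decide
  rw [e] at h
  exact h

/-- `[K:ℚ] = 32`: `dim B⁵(A) − dim D⁵(A) ≥ 480` and `dim B⁶(A) − dim D⁶(A) ≥ 1680` on every simple degenerate CM `16`-fold.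
[cite: MoonenZarhin1998WeilClasses, Criterion (Q2) (proof)] [cite: Gordon1999HodgeAVSurvey, 9.2.2] -/
theorem le_finrank_sub_five_six_of_finrank_eq_thirtytwo (hexp : ∀ g : K ≃ₐ[ℚ] K, g ^ 2 = 1)
    (h32 : finrank ℚ K = 32) (Φ : CMType K) (hA : IsCMTypeRealisation Φ A ι θ) (hs : A.IsSimple)
    (hnd : ¬ IsNondegenerate Φ) :
    480 ≤ Module.finrank ℂ ↥(hodgeClassSpan (finrank ℚ K / 2) A.X 5) -
        Module.finrank ℂ ↥(divisorClassesSpan A.X (finrank ℚ K / 2) 5) ∧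
      1680 ≤ Module.finrank ℂ ↥(hodgeClassSpan (finrank ℚ K / 2) A.X 6) -
        Module.finrank ℂ ↥(divisorClassesSpan A.X (finrank ℚ K / 2) 6) := by
  have h1 := sixty_mul_choose_le_finrank_sub_of_finrank_eq_thirtytwo hexp h32 Φ hA hs hnd 1
  have h2 := sixty_mul_choose_le_finrank_sub_of_finrank_eq_thirtytwo hexp h32 Φ hA hs hnd 2
  have e1 : 60 * Nat.choose 8 1 = 480 := by decide
  have e2 : 60 * Nat.choose 8 2 = 1680 := by decide
  rw [e1] at h1
  rw [e2] at h2
  exact ⟨h1, h2⟩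

/-- **EXISTENCE** (`[K:ℚ] = 32`): on every multiquadratic CM field of degree `32` there is a CM type all of whose abelian
varieties are simple `16`-folds with `dim B⁸ − dim D⁸ ≥ 4200`, and such an abelian variety exists.
[cite: Shimura1998, §6.2 Thm. 3] [cite: MoonenZarhin1998WeilClasses, Criterion (Q2)] [cite: Dodson1984, §3.2.1] -/
theorem exists_isSimple_sixteenfold_fortyTwoHundred_of_finrank_eq_thirtytwo (hexp : ∀ g : K ≃ₐ[ℚ] K, g ^ 2 = 1)
    (h32 : finrank ℚ K = 32) :
    ∃ (Φ : CMType K) (A : AbelianVariety ℂ) (ι : 𝓞 K →+* End A) (θ : K →+* Module.End ℂ (complexBetti A.X 1)),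
      IsCMTypeRealisation Φ A ι θ ∧ cmTypeRank Φ = 11 ∧ A.IsSimple ∧ A.dim = 16 ∧
        4200 ≤ Module.finrank ℂ ↥(hodgeClassSpan (finrank ℚ K / 2) A.X 8) -
          Module.finrank ℂ ↥(divisorClassesSpan A.X (finrank ℚ K / 2) 8) := by
  obtain ⟨Φ, hr, hnd, -⟩ := exists_isPrimitive_cmTypeRank_eq_eleven hexp h32
  obtain ⟨A, ι, θ, hA⟩ := exists_isCMTypeRealisation Φ
  have hs : A.IsSimple := (isSimple_iff_cmTypeRank_eq_eleven_or_seventeen hexp h32 Φ hA).2 (Or.inl hr)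
  have hdim : A.dim = finrank ℚ K / 2 := Literature.AlgebraicGeometry.Motives.schemeDim_eq_holds hA.1
  exact ⟨Φ, A, ι, θ, hA, hr, hs, by rw [hdim, h32],
    fortyTwoHundred_le_finrank_sub_of_finrank_eq_thirtytwo hexp h32 Φ hA hs hnd⟩

end ThirtyTwo

/-! ## §4 Degree `64`: primitive types of rank `17` -/

section SixtyFour

variable {K : Type} [Field K] [NumberField K] [IsCMField K] [IsGalois ℚ K]
  {A : AbelianVariety ℂ} {ι : 𝓞 K →+* End A} {θ : K →+* Module.End ℂ (complexBetti A.X 1)}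

/-- **`[K:ℚ] = 64`, `Φ` PRIMITIVE OF RANK `17`: `dim B^{8+j}(A) − dim D^{8+j}(A) ≥ 480·C(16, j)`**; in the middle degree
`dim B¹⁶(A) − dim D¹⁶(A) ≥ 480·C(16, 8) = 6177600`. [cite: MoonenZarhin1998WeilClasses, Criterion (Q2) (proof)]
[cite: Gordon1999HodgeAVSurvey, 9.2.2] [cite: Dodson1984, §3.1.1 Theorem] -/
theorem fourHundredEighty_mul_choose_le_finrank_sub_of_finrank_eq_sixtyFour (hexp : ∀ g : K ≃ₐ[ℚ] K, g ^ 2 = 1)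
    (h64 : finrank ℚ K = 64) (Φ : CMType K) (h1 : Nat.card (twistStabilizer Φ) = 1) (hr : cmTypeRank Φ = 17)
    (hA : IsCMTypeRealisation Φ A ι θ) (j : ℕ) :
    480 * Nat.choose 16 j ≤ Module.finrank ℂ ↥(hodgeClassSpan (finrank ℚ K / 2) A.X (8 + j)) -
        Module.finrank ℂ ↥(divisorClassesSpan A.X (finrank ℚ K / 2) (8 + j)) := by
  have hbot : twistStabilizer Φ = ⊥ := Subgroup.eq_bot_of_card_eq (twistStabilizer Φ) h1
  have h := four_mul_choose_mul_choose_le_finrank_sub_of_twistStabilizer_eq_bot hexp Φ hbot (m := 8)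
    (by rw [h64]) hA j
  have e : 4 * Nat.choose (finrank ℚ K / 2 + 1 - cmTypeRank Φ) 2 = 480 := by rw [hr, h64]; decide
  rw [e] at h
  exact h

/-- **`[K:ℚ] = 64`, MIDDLE COHOMOLOGY of the simple `32`-folds of a primitive rank-`17` type: `dim B¹⁶ − dim D¹⁶ ≥ 6177600`.**
[cite: MoonenZarhin1998WeilClasses, Criterion (Q2) (proof)] [cite: Gordon1999HodgeAVSurvey, 9.2.2] -/
theorem middle_le_finrank_sub_of_finrank_eq_sixtyFour (hexp : ∀ g : K ≃ₐ[ℚ] K, g ^ 2 = 1)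
    (h64 : finrank ℚ K = 64) (Φ : CMType K) (h1 : Nat.card (twistStabilizer Φ) = 1) (hr : cmTypeRank Φ = 17)
    (hA : IsCMTypeRealisation Φ A ι θ) :
    6177600 ≤ Module.finrank ℂ ↥(hodgeClassSpan (finrank ℚ K / 2) A.X 16) -
        Module.finrank ℂ ↥(divisorClassesSpan A.X (finrank ℚ K / 2) 16) := by
  have h := fourHundredEighty_mul_choose_le_finrank_sub_of_finrank_eq_sixtyFour hexp h64 Φ h1 hr hA 8
  have e : 480 * Nat.choose 16 8 = 6177600 := by decide
  rw [e] at h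
  exact h

/-- **EXISTENCE** (`[K:ℚ] = 64`): a primitive near-bent CM type (tree) gives simple `32`-folds with
`dim B¹⁶ − dim D¹⁶ ≥ 6177600`; such abelian varieties exist over every multiquadratic CM field of degree `64`.
[cite: Shimura1998, §6.2 Thm. 3] [cite: MoonenZarhin1998WeilClasses, Criterion (Q2)] -/
theorem exists_isSimple_thirtyTwofold_middle_of_finrank_eq_sixtyFour (hexp : ∀ g : K ≃ₐ[ℚ] K, g ^ 2 = 1)
    (h64 : finrank ℚ K = 64) :
    ∃ (Φ : CMType K) (A : AbelianVariety ℂ) (ι : 𝓞 K →+* End A) (θ : K →+* Module.End ℂ (complexBetti A.X 1)),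
      IsCMTypeRealisation Φ A ι θ ∧ cmTypeRank Φ = 17 ∧ A.IsSimple ∧ A.dim = 32 ∧
        6177600 ≤ Module.finrank ℂ ↥(hodgeClassSpan (finrank ℚ K / 2) A.X 16) -
          Module.finrank ℂ ↥(divisorClassesSpan A.X (finrank ℚ K / 2) 16) := by
  obtain ⟨φ₀⟩ := (inferInstance : Nonempty (K →+* ℂ))
  obtain ⟨Φ, -, h1, hr, -, hall⟩ := exists_isSimple_exceptional_nearBent_of_finrank_eq_sixtyFour hexp φ₀ h64
  obtain ⟨A, ι, θ, hA⟩ := exists_isCMTypeRealisation Φ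
  obtain ⟨hS, hd, -⟩ := hall A ι θ hA
  exact ⟨Φ, A, ι, θ, hA, hr, hS, hd, middle_le_finrank_sub_of_finrank_eq_sixtyFour hexp h64 Φ h1 hr hA⟩

end SixtyFour

end MultiquadraticWeilSubfieldsProducts

end Literature.AlgebraicGeometry.Pohlmann1968
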